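import Literature.AlgebraicGeometry.Frobenioids.MonoidFunctors
import Literature.AnabelianGeometry.EtaleTheta.TemperedFrobenioid

/-!
# [EtTh] Def 3.3 (iii) / 3.6 (i) / 3.6 (ii): the interface stack is inhabited (consistency witness)

S. Mochizuki, *The étale theta function …*, Publ. RIMS **45** (2009) [MochizukiEtTh2009], Def 3.3 (iii)
p.73, Def 3.6 (i)–(ii) pp.76–77.  The statement files `DivisorMonoids.lean`, `TemperedFrobenioid.lean`
(abc-iut-L2-t3) type the data `(Φ₀, B₀, B₀ → Φ₀^gp, F₀)`, its realified form (`RealifiedDivisorMonoids`,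
v2 with the additive fields `isUnit_BΛ`, `cnstR_root`, `cnst_le_cnstR`) and the tempered Frobenioid
(`TemperedFrobenioid`: `Φ ⊆ Φ^{ℝ-log}` group-saturated, `Φ^{bs-fld}` monoprime, `F → (Φ^{bs-fld})^gp`
nonzero, …) as INTERFACES.  This file (owner, gen 2) builds ONE inhabitant of the whole stack — the
degenerate "one covering, one prime" model over the one-object base category: `Φ₀ = Φ^{ℝ-log} = Φ = ℕ`
(one prime), `B₀ = B₀^Λ = ℤ` with `div = (n ↦ n·𝔭)`, all functions constant (`F₀ = B₀`), `ℝ·Φ₀^cnst =`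
everything, `Λ = ℤ` — over the TRIVIAL [FrdI] vocabularies (every vocabulary predicate `True`).  It
certifies exactly that the non-vocabulary fields of the three structures (in particular the v2 fields and
Def 3.6 (ii) (a) "`Φ^{bs-fld}` monoprime" [REAL `IsMonoprime`], (b) "`F(A) → (Φ^{bs-fld})^gp(A)` nonzero",
group-saturatedness) are JOINTLY SATISFIABLE; it is NOT a tempered Frobenioid of a curve and says nothing
about the vocabulary-carried clauses (perf-factorial, realification, divisorial-on-`D`).  HONEST FRAMING:
a consistency check of typed interfaces; nothing here bears on [IUTchIII] Cor. 3.12.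
-/

noncomputable section

namespace Literature.AnabelianGeometry.EtaleTheta

open CategoryTheory Opposite Literature.AlgebraicGeometry.Frobenioids

namespace Toy

/-- The trivial [FrdI] monoid vocabulary (every predicate `True`). [cite: MochizukiEtTh2009, Def 3.6 p.76] -/
def monoidVocab : FrdIMonoidStub.{0} where
  IsPerfFactorial _ _ := True
  IsRealification _ _ _ _ _ := True
  RSupports _ _ := True
  IsNonDilating _ _ _ := True

/-- The trivial [FrdI] category vocabulary on the one-object category. [cite: MochizukiEtTh2009, Def 3.6 p.77] -/
def catVocab : FrdICatStub.{0, 0, 0} (Discrete PUnit.{1}) where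
  IsDivisorialOn _ := True
  IsRational _ := True
  IsStrictlyRational _ := True

/-- The divisor of the "uniformiser": `ℤ → ℕ^gp`, `n ↦ 𝔭ⁿ`. [cite: MochizukiEtTh2009, Def 3.3 p.73] -/
def divHom : Multiplicative ℤ →* Algebra.GrothendieckGroup (Multiplicative ℕ) :=
  zpowersHom _ (Algebra.GrothendieckGroup.of (Multiplicative.ofAdd 1))

/-- `divHom 1 = 𝔭`. [cite: MochizukiEtTh2009, Def 3.3 p.73] -/
theorem divHom_ofAdd_one :
    divHom (Multiplicative.ofAdd 1) = Algebra.GrothendieckGroup.of (Multiplicative.ofAdd 1) := by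
  rw [divHom, zpowersHom_apply, toAdd_ofAdd, zpow_one]

/-- `gpMap id = id`, pointwise (the constant functors' transition maps). [folklore] -/
private theorem gpMap_id_apply {M : Type} [CommMonoid M] (x : Algebra.GrothendieckGroup M) :
    gpMap (MonoidHom.id M) x = x :=
  DFunLike.congr_fun (Literature.AlgebraicGeometry.Frobenioids.gpMap_id (M := M)) x

/-- **Def 3.3 (iii) data, degenerate inhabitant**: `Φ₀ = ℕ`, `B₀ = ℤ`, `div₀ = (n ↦ 𝔭ⁿ)`, `F₀ = B₀`,
everything non-cuspidal, over the one-object base category. [cite: MochizukiEtTh2009, Def 3.3 p.73] -/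
def divisorMonoids : DivisorMonoids.{0, 0, 0} (Discrete PUnit.{1}) where
  Φ₀ := (Functor.const _).obj (CommMonCat.of (Multiplicative ℕ))
  B₀ := (Functor.const _).obj (CommMonCat.of (Multiplicative ℤ))
  isUnit_B₀ _ b := by
    change IsUnit (M := Multiplicative ℤ) b
    exact Group.isUnit _
  div₀ _ := divHom
  div₀_natural _ b := (gpMap_id_apply (divHom b)).symm
  F₀ _ := ⊤
  F₀_map _ _ _ := trivial
  ncsp₀ _ := ⊤
  csp₀ _ := ⊥
  ncsp₀_map _ _ _ := trivial
  csp₀_map _ x hx := by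
    rw [Submonoid.mem_bot] at hx ⊢
    rw [hx, map_one]
  existsUnique_ncsp_csp _ x := by
    refine ⟨(⟨x, trivial⟩, ⟨1, Submonoid.mem_bot.mpr rfl⟩), mul_one x, ?_⟩
    rintro ⟨a, c⟩ h
    have hc : c.1 = 1 := Submonoid.mem_bot.mp c.2
    have ha : a.1 = x := by
      have h' : a.1 * c.1 = x := h
      rwa [hc, mul_one] at h'
    exact Prod.ext (Subtype.ext ha) (Subtype.ext hc)

/-- **Def 3.6 (i) data, degenerate inhabitant** (`Λ = ℤ`, `Φ₀^ℝ = Φ₀`, `B₀^Λ = B₀`, `ℝ·Φ₀^cnst =` all of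
`(Φ₀^ℝ)^gp`), over the trivial vocabulary. [cite: MochizukiEtTh2009, Def 3.6 p.76] -/
def realified : RealifiedDivisorMonoids (D₀ := Discrete PUnit.{1}) monoidVocab where
  toDivisorMonoids := divisorMonoids
  Λ := MonoidType.Z
  ΦR := (Functor.const _).obj (CommMonCat.of (Multiplicative ℕ))
  toR _ := MonoidHom.id _
  toR_natural _ _ := rfl
  isRealification _ := trivial
  BΛ := (Functor.const _).obj (CommMonCat.of (Multiplicative ℤ))
  isUnit_BΛ _ b := by
    change IsUnit (M := Multiplicative ℤ) b
    exact Group.isUnit _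
  divΛ _ := divHom
  divΛ_natural _ b := (gpMap_id_apply (divHom b)).symm
  FΛ _ := ⊤
  FΛ_map _ _ _ := trivial
  cnstR _ := ⊤
  cnstR_map _ _ _ := trivial
  divΛ_mem_cnstR _ _ _ := trivial
  cnstR_root _ _ _ _ := trivial
  cnst_le_cnstR _ _ _ := trivial
  ncspR _ := ⊤
  cspR _ := ⊥
  toR_ncsp _ _ _ := trivial
  toR_csp _ _ hx := hx

/-- A submonoid of `ℕ` which is everything is `ℤ`-monoprime (`Φ^{bs-fld}` of the toy).
[cite: MochizukiEtTh2009, Def 3.6 p.77] -/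
theorem isMonoprime_of_eq_top {S : Submonoid (Multiplicative ℕ)} (hS : S = ⊤) : IsMonoprime ↥S := by
  subst hS
  exact IsMonoprime.ofZ ⟨⟨Submonoid.topEquiv⟩⟩

/-- **Def 3.6 (ii), degenerate inhabitant**: the tempered-Frobenioid interface over the toy data with
`D = D₀` the one-object category and `Φ = Φ^{ℝ-log}`: group-saturated (trivially), `Φ^{bs-fld} = ℕ`
monoprime (REAL), and the constant `1 ∈ ℤ = F` has divisor `𝔭 ≠ 0` (condition (b), REAL).
[cite: MochizukiEtTh2009, Def 3.6 p.77] -/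
def temperedFrobenioid : TemperedFrobenioid realified (Discrete PUnit.{1}) catVocab where
  isConnected := zigzag_isConnected fun j₁ j₂ => by rw [Subsingleton.elim j₁ j₂]
  isTotallyEpimorphic := ⟨fun f => ⟨fun _ _ _ => Subsingleton.elim _ _⟩⟩
  base := 𝟭 _
  Φ := ⟨fun _ => ⊤, fun _ _ _ => trivial⟩
  isGroupSaturated A := (isGroupSaturated_iff' _).2 fun _ _ _ _ _ _ => trivial
  isPerfFactorial _ := trivial
  isDivisorialOn := trivial
  isMonoprime_bsFld A := isMonoprime_of_eq_top
    (eq_top_iff.2 fun x _ => Submonoid.mem_inf.2 ⟨Submonoid.mem_top x,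
      (Subgroup.mem_top (Algebra.GrothendieckGroup.of x) :
        Algebra.GrothendieckGroup.of x ∈ (⊤ : Subgroup (Algebra.GrothendieckGroup (Multiplicative ℕ))))⟩)
  exists_FΛ_div_ne A := ⟨(Multiplicative.ofAdd (1 : ℤ) : Multiplicative ℤ), trivial,
    (Multiplicative.ofAdd (1 : ℕ) : Multiplicative ℕ), trivial, (1 : Multiplicative ℕ), trivial,
    fun h => Nat.one_ne_zero (Multiplicative.ofAdd.injective h),
    divHom_ofAdd_one.trans (by
      change Algebra.GrothendieckGroup.of (M := Multiplicative ℕ) (Multiplicative.ofAdd 1) =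
        Algebra.GrothendieckGroup.of (M := Multiplicative ℕ) (Multiplicative.ofAdd 1) /
          Algebra.GrothendieckGroup.of (M := Multiplicative ℕ) 1
      rw [(Algebra.GrothendieckGroup.of (M := Multiplicative ℕ)).map_one, div_one])⟩

/-- The interface stack of Def 3.3 (iii) / 3.6 (i) / 3.6 (ii) is inhabited (over the trivial
vocabularies). [cite: MochizukiEtTh2009, Def 3.6 p.77] -/
theorem nonempty_temperedFrobenioid :
    Nonempty (TemperedFrobenioid realified (Discrete PUnit.{1}) catVocab) :=
  ⟨temperedFrobenioid⟩

end Toy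

end Literature.AnabelianGeometry.EtaleTheta
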